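import Mathlib
import Literature.LinearAlgebra.Matrix.SylvesterDeterminantIdentity
import Summits.ValiantsHypothesis.ValiantsHypothesis.Theorems.LacunarySymmetroidMatrixDescartesCensusDefs

/-!
# Tower graft line — SYLVESTER'S IDENTITY IN CLASS CURRENCY (size-compression mechanism, S4f side)

Mechanism file for the line `Cruxes/WeakLifting/Lines/tower_graft.lean` (crux `WeakLifting` = stmt-ValiantsHypothesis-19561,
restricted sub-case `TowerWeakLifting`; size-induction spine S4f `stub_sizeDoublingPoly`, planner memo `Lines/tower_graft-S5.md` §6
«T5: Sylvester IS the size-doubling identity»).  NO stub is claimed.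

Sylvester's identity for bordered determinants is the tree's `Literature.LinearAlgebra.Matrix.det_borderedMinors`
(Horn–Johnson (0.8.6.1)): for a square block matrix `A = fromBlocks P B C D` with pivot block `P = A[α]` and bordered-minor matrix
`𝔅 = [det A[α ∪ {i}, α ∪ {j}]]_{i,j ∉ α}` one has `det 𝔅 = (det P)^{|αᶜ|−1} · det A`.  Read on a SYMMETRIC POLYNOMIAL matrix this is a
SIZE COMPRESSION inside the class currency of the cell (`PosRootLawOn`: distinct positive zeros of determinants of symmetric pencils):

* `borderedMinors_transpose`, `isSymm_borderedMinors` — `𝔅` is symmetric when `A` is;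
* `roots_det_le_roots_det_borderedMinors`, `card_posRoots_det_le_borderedMinors` — over `ℝ[X]`, if the pivot determinant `det P` is not
  the zero polynomial, every root of `det A` is a root of `det 𝔅` (multiplicities included), so `Z₊(det A) ≤ Z₊(det 𝔅)` and
  `Z(det A) ≤ Z(det 𝔅)`;
* `submatrix_pencil`, `coeff_det_pencil_eq_zero_of_ne` — minors of a lacunary pencil `Σₗ X^{dₗ} Sₗ` are pencils on the same support, whose
  determinants are supported on sums `Σᵢ d (f i)`;
* `borderedMinors_pencil_apply`, `coeff_borderedMinors_pencil_eq_zero` — for `A` = a pencil of size `N` reindexed along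
  `e : ι ⊕ μ ≃ Fin N`, every entry of `𝔅` is the determinant of an `(|ι|+1)`-pencil on the support `d` (letters = the corresponding
  minors of the `Sₗ`), hence supported on the `(|ι|+1)`-fold sumset of `d`;
* `card_posRoots_pencil_le_sylvester` — the headline: for a symmetric `N`-pencil whose pivot block has non-vanishing determinant,
  `Z₊(det Σₗ X^{dₗ} Sₗ) ≤ Z₊(det 𝔅)`, `𝔅` a symmetric `|μ| × |μ|` polynomial matrix (`|μ| = N − |ι|`; with `N = 2s−1`, `|ι| = s−1`
  this is the memo's `B_s`).

So a class law for the determinants of these MINOR PENCILS (the memo's T5, untyped) would give the size-doubling law S4f for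
non-degenerate pivots; the degenerate pivots are a nowhere-dense set of letters (companion file «generic letters suffice»).
Def-free; Mathlib + the Literature Sylvester file + the cell's `…CensusDefs`.  HONEST FRAMING: bookkeeping around a classical identity;
T5, S4f, `WeakLifting`, Conjecture B / `KPlusLogSqLaw`, `MatrixDescartes` (18050) and `VP ≠ VNP` are untouched.
Seat: prover val-sym-lift-p2 g18, `--supports stmt-ValiantsHypothesis-19561`.
-/

-- `Summit.ValiantsHypothesis.ValiantsHypothesis.…` repeats a component by the D-0017 layout
-- (single-conjunct summit), which the `dupNamespace` linter flags; the name is mandated.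
set_option linter.dupNamespace false

namespace Summit.ValiantsHypothesis.ValiantsHypothesis.Theorems.KPlusLogSqLaw.TowerGraft

open Finset Polynomial Matrix
open scoped BigOperators Polynomial
open Literature.LinearAlgebra.Matrix (borderedMinors borderedMinors_apply det_borderedMinors fromBlocks_submatrix_sum_map)

section CommRing

variable {R : Type*} [CommRing R] {ι μ ν : Type*} [Fintype ι] [DecidableEq ι]

/-- transposing the block data transposes the matrix of bordered minors. [folklore] -/
theorem borderedMinors_transpose (P : Matrix ι ι R) (B : Matrix ι ν R) (C : Matrix μ ι R) (D : Matrix μ ν R) :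
    (borderedMinors P B C D)ᵀ = borderedMinors Pᵀ Cᵀ Bᵀ Dᵀ := by
  ext i j
  rw [transpose_apply, borderedMinors_apply, borderedMinors_apply, ← det_transpose, fromBlocks_transpose]
  rfl

/-- the bordered-minor matrix of a symmetric block matrix is symmetric. [folklore] -/
theorem isSymm_borderedMinors {P : Matrix ι ι R} {B : Matrix ι μ R} {C : Matrix μ ι R} {D : Matrix μ μ R}
    (hP : P.IsSymm) (hBC : Bᵀ = C) (hD : D.IsSymm) : (borderedMinors P B C D).IsSymm := by
  have hCB : Cᵀ = B := by rw [← hBC, transpose_transpose]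
  rw [Matrix.IsSymm, borderedMinors_transpose, hP.eq, hCB, hBC, hD.eq]

/-- read on `A : Matrix (ι ⊕ μ) (ι ⊕ μ) R`: `A` symmetric ⇒ its bordered-minor matrix (pivot `A.toBlocks₁₁`) is symmetric. [folklore] -/
theorem isSymm_borderedMinors_toBlocks {A : Matrix (ι ⊕ μ) (ι ⊕ μ) R} (hA : A.IsSymm) :
    (borderedMinors A.toBlocks₁₁ A.toBlocks₁₂ A.toBlocks₂₁ A.toBlocks₂₂).IsSymm := by
  refine isSymm_borderedMinors ?_ ?_ ?_
  · ext i j; exact hA.apply (Sum.inl i) (Sum.inl j)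
  · ext i j; exact hA.apply (Sum.inr i) (Sum.inl j)
  · ext i j; exact hA.apply (Sum.inr i) (Sum.inr j)

/-- an entry of the bordered-minor matrix of `A : Matrix (ι ⊕ μ) (ι ⊕ ν) R` is the determinant of the square submatrix of `A` on
`α ∪ {i}`, `α ∪ {j}`. [folklore] -/
theorem borderedMinors_toBlocks_apply (A : Matrix (ι ⊕ μ) (ι ⊕ ν) R) (i : μ) (j : ν) :
    borderedMinors A.toBlocks₁₁ A.toBlocks₁₂ A.toBlocks₂₁ A.toBlocks₂₂ i j =
      (A.submatrix (Sum.map id fun _ : Unit => i) (Sum.map id fun _ : Unit => j)).det := by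
  rw [borderedMinors_apply, ← fromBlocks_submatrix_sum_map, fromBlocks_toBlocks]

end CommRing

section Roots

variable {ι μ : Type*} [Fintype ι] [DecidableEq ι] [Fintype μ] [DecidableEq μ]

/-- **Sylvester compression, root form**: if the pivot determinant is not the zero polynomial and `det A ≠ 0`, the roots of `det A`
(with multiplicity) are among the roots of the determinant of the bordered-minor matrix. [folklore] -/
theorem roots_det_le_roots_det_borderedMinors [Nonempty μ] (A : Matrix (ι ⊕ μ) (ι ⊕ μ) ℝ[X])
    (hP : A.toBlocks₁₁.det ≠ 0) (hA : A.det ≠ 0) :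
    A.det.roots ≤ (borderedMinors A.toBlocks₁₁ A.toBlocks₁₂ A.toBlocks₂₁ A.toBlocks₂₂).det.roots := by
  rw [Literature.LinearAlgebra.Matrix.det_borderedMinors_toBlocks,
    Polynomial.roots_mul (mul_ne_zero (pow_ne_zero _ hP) hA)]
  exact Multiset.le_add_left _ _

/-- **Sylvester compression in class currency**: `Z₊(det A) ≤ Z₊(det 𝔅)` (distinct positive roots) whenever the pivot determinant
is not the zero polynomial. [folklore] -/
theorem card_posRoots_det_le_borderedMinors [Nonempty μ] (A : Matrix (ι ⊕ μ) (ι ⊕ μ) ℝ[X])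
    (hP : A.toBlocks₁₁.det ≠ 0) :
    (A.det.roots.toFinset.filter (fun t => 0 < t)).card ≤
      ((borderedMinors A.toBlocks₁₁ A.toBlocks₁₂ A.toBlocks₂₁ A.toBlocks₂₂).det.roots.toFinset.filter
        (fun t => 0 < t)).card := by
  by_cases hA : A.det = 0
  · simp [hA]
  exact Finset.card_le_card (Finset.filter_subset_filter _
    (Multiset.toFinset_subset.mpr (Multiset.subset_of_le (roots_det_le_roots_det_borderedMinors A hP hA))))

/-- the same for ALL distinct real roots (`RealRootLawAt` currency). [folklore] -/
theorem card_roots_det_le_borderedMinors [Nonempty μ] (A : Matrix (ι ⊕ μ) (ι ⊕ μ) ℝ[X])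
    (hP : A.toBlocks₁₁.det ≠ 0) :
    A.det.roots.toFinset.card ≤
      (borderedMinors A.toBlocks₁₁ A.toBlocks₁₂ A.toBlocks₂₁ A.toBlocks₂₂).det.roots.toFinset.card := by
  by_cases hA : A.det = 0
  · simp [hA]
  exact Finset.card_le_card
    (Multiset.toFinset_subset.mpr (Multiset.subset_of_le (roots_det_le_roots_det_borderedMinors A hP hA)))

end Roots

section Pencil

variable {K : ℕ}

/-- a (rectangular) submatrix of a lacunary pencil is the pencil of the submatrices of its letters. [folklore] -/
theorem submatrix_pencil {n n' : Type*} {N : ℕ} (d : Fin K → ℕ) (S : Fin K → Matrix (Fin N) (Fin N) ℝ) (ρ : n → Fin N)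
    (γ : n' → Fin N) :
    (∑ l, ((X : ℝ[X]) ^ d l) • (S l).map Polynomial.C).submatrix ρ γ =
      ∑ l, ((X : ℝ[X]) ^ d l) • ((S l).submatrix ρ γ).map Polynomial.C := by
  ext i j
  simp [Matrix.submatrix_apply, Matrix.sum_apply, Matrix.smul_apply]

/-- Leibniz: the determinant of a pencil with letters indexed by any finite type `n` is a sum of monomials `X^{Σᵢ d (f i)}` over
row-to-letter maps `f : n → Fin K`. [folklore] -/
theorem det_pencil_eq_sum {n : Type*} [Fintype n] [DecidableEq n] (d : Fin K → ℕ) (T : Fin K → Matrix n n ℝ) :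
    (∑ l, ((X : ℝ[X]) ^ d l) • (T l).map Polynomial.C).det =
      ∑ σ : Equiv.Perm n, ∑ f : n → Fin K,
        ((Equiv.Perm.sign σ : ℤ) : ℝ[X]) * (Polynomial.C (∏ i, T (f i) (σ i) i) * X ^ (∑ i, d (f i))) := by
  rw [Matrix.det_apply']
  refine Finset.sum_congr rfl fun σ _ => ?_
  rw [← Finset.mul_sum]
  congr 1
  have happ : ∀ i j, (∑ l, ((X : ℝ[X]) ^ d l) • (T l).map Polynomial.C) i j = ∑ l, X ^ d l * Polynomial.C (T l i j) := by
    intro i j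
    simp [Matrix.sum_apply, Matrix.smul_apply, smul_eq_mul]
  simp_rw [happ]
  rw [Fintype.prod_sum]
  refine Finset.sum_congr rfl fun f _ => ?_
  rw [Finset.prod_mul_distrib, Finset.prod_pow_eq_pow_sum, ← map_prod Polynomial.C, mul_comm]

/-- the determinant of such a pencil has no coefficient off the exponent set `{Σᵢ d (f i)}`. [folklore] -/
theorem coeff_det_pencil_eq_zero_of_ne {n : Type*} [Fintype n] [DecidableEq n] (d : Fin K → ℕ) (T : Fin K → Matrix n n ℝ) {e : ℕ}
    (he : ∀ f : n → Fin K, (∑ i, d (f i)) ≠ e) :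
    (∑ l, ((X : ℝ[X]) ^ d l) • (T l).map Polynomial.C).det.coeff e = 0 := by
  rw [det_pencil_eq_sum, finsetSum_coeff]
  refine Finset.sum_eq_zero fun σ _ => ?_
  rw [finsetSum_coeff]
  refine Finset.sum_eq_zero fun f _ => ?_
  rw [← C_eq_intCast, ← mul_assoc, ← C_mul, coeff_C_mul_X_pow, if_neg (fun h => he f h.symm)]

variable {ι μ : Type*} [Fintype ι] [DecidableEq ι]

/-- **the entries of the bordered-minor matrix of a reindexed pencil are determinants of `(|ι|+1)`-pencils on the same support**
(letters: the corresponding minors of the `Sₗ`). [folklore] -/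
theorem borderedMinors_pencil_apply {N : ℕ} (e : ι ⊕ μ ≃ Fin N) (d : Fin K → ℕ) (S : Fin K → Matrix (Fin N) (Fin N) ℝ)
    (i j : μ) :
    let A := (∑ l, ((X : ℝ[X]) ^ d l) • (S l).map Polynomial.C).submatrix e e
    borderedMinors A.toBlocks₁₁ A.toBlocks₁₂ A.toBlocks₂₁ A.toBlocks₂₂ i j =
      (∑ l, ((X : ℝ[X]) ^ d l) • ((S l).submatrix (e ∘ Sum.map id fun _ : Unit => i)
        (e ∘ Sum.map id fun _ : Unit => j)).map Polynomial.C).det := by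
  intro A
  rw [borderedMinors_toBlocks_apply, Matrix.submatrix_submatrix, submatrix_pencil]

/-- hence every entry of that bordered-minor matrix is supported on the `(|ι|+1)`-fold sumset of the support `d`. [folklore] -/
theorem coeff_borderedMinors_pencil_eq_zero {N : ℕ} (e : ι ⊕ μ ≃ Fin N) (d : Fin K → ℕ)
    (S : Fin K → Matrix (Fin N) (Fin N) ℝ) (i j : μ) {x : ℕ} (hx : ∀ f : ι ⊕ Unit → Fin K, (∑ a, d (f a)) ≠ x) :
    let A := (∑ l, ((X : ℝ[X]) ^ d l) • (S l).map Polynomial.C).submatrix e e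
    (borderedMinors A.toBlocks₁₁ A.toBlocks₁₂ A.toBlocks₂₁ A.toBlocks₂₂ i j).coeff x = 0 := by
  intro A
  rw [borderedMinors_pencil_apply]
  exact coeff_det_pencil_eq_zero_of_ne d _ hx

/-- **SYLVESTER COMPRESSION OF A SYMMETRIC PENCIL (headline).**  For a symmetric `N`-pencil `G = Σₗ X^{dₗ} Sₗ` split along
`e : ι ⊕ μ ≃ Fin N` with non-degenerate pivot block (`det G[ι, ι] ≢ 0`), the number of distinct positive zeros of `det G` is at most
that of `det 𝔅`, `𝔅` the SYMMETRIC `|μ| × |μ|` bordered-minor matrix of `G` — whose entries are determinants of `(|ι|+1)`-pencils on `d`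
(`borderedMinors_pencil_apply`).  With `N = 2s−1`, `|ι| = s−1`, `|μ| = s`: the memo's «`Z₊(det G_{2s−1}) ≤ Z₊(det B_s)`». [this work] -/
theorem card_posRoots_pencil_le_sylvester [Fintype μ] [DecidableEq μ] [Nonempty μ] {N : ℕ} (e : ι ⊕ μ ≃ Fin N) (d : Fin K → ℕ)
    (S : Fin K → Matrix (Fin N) (Fin N) ℝ) (hS : ∀ l, (S l).IsSymm)
    (hpiv : (∑ l, ((X : ℝ[X]) ^ d l) • ((S l).submatrix (e ∘ Sum.inl) (e ∘ Sum.inl)).map Polynomial.C).det ≠ 0) :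
    let A := (∑ l, ((X : ℝ[X]) ^ d l) • (S l).map Polynomial.C).submatrix e e
    (borderedMinors A.toBlocks₁₁ A.toBlocks₁₂ A.toBlocks₂₁ A.toBlocks₂₂).IsSymm ∧
    ((∑ l, ((X : ℝ[X]) ^ d l) • (S l).map Polynomial.C).det.roots.toFinset.filter (fun t => 0 < t)).card ≤
      ((borderedMinors A.toBlocks₁₁ A.toBlocks₁₂ A.toBlocks₂₁ A.toBlocks₂₂).det.roots.toFinset.filter
        (fun t => 0 < t)).card := by
  intro A
  have hGsymm : (∑ l, ((X : ℝ[X]) ^ d l) • (S l).map Polynomial.C).IsSymm := by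
    rw [Matrix.IsSymm, Matrix.transpose_sum]
    refine Finset.sum_congr rfl fun l _ => ?_
    rw [Matrix.transpose_smul, ← Matrix.transpose_map, (hS l).eq]
  have hA : A.IsSymm := hGsymm.submatrix e
  have hP : A.toBlocks₁₁.det ≠ 0 := by
    have h1 : A.toBlocks₁₁ = (∑ l, ((X : ℝ[X]) ^ d l) • (S l).map Polynomial.C).submatrix (e ∘ Sum.inl) (e ∘ Sum.inl) := by
      ext a b; rfl
    rwa [h1, submatrix_pencil]
  refine ⟨isSymm_borderedMinors_toBlocks hA, ?_⟩
  have hdet : (∑ l, ((X : ℝ[X]) ^ d l) • (S l).map Polynomial.C).det = A.det :=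
    (Matrix.det_submatrix_equiv_self e _).symm
  rw [hdet]
  exact card_posRoots_det_le_borderedMinors A hP

end Pencil

end Summit.ValiantsHypothesis.ValiantsHypothesis.Theorems.KPlusLogSqLaw.TowerGraft
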